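import Summits.CriticalPhenomena.PercolationContinuityZ3.Theorems.PercShatteringRaceJumpUniquenessBoxLRO
import Literature.Probability.Percolation.CerfUniquenessZoneBound
import Literature.Probability.Percolation.CriticalContinuityProofs
import HarnessLib

/-!
# Crux `PercShatteringRace.NearLinearTwoClusterDecay` (stmt-CriticalPhenomena-5785) — engine stub E1 `stub_lossyStep`

Helper file of the line `pair-decay-long-arms-dense` (lead c5); lands with `--supports stmt-CriticalPhenomena-5785`
(registered stub `stub_lossyStep` of skeleton rev L5-c5).

## Statement

For real exponents `1 ≤ x < A` and `κ > 0`, at `p = p_c(ℤ³)` (bond percolation): a two-arms exponent `κ`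
(`P(edgeTwoArms i m) ≤ C m^{-κ}` for `m ≥ 1`) and pair long-range order at aspect `x` (eventually in `u`,
`P(a ↔ b inside Λ_{⌈u^x⌉}) ≥ δ > 0` for all `a, b ∈ Λ_u`) give, for every `ζ ≤ κA − 6 − 6x`, the
union-form two-cluster rate `P((uniqZone u ⌈u^A⌉)ᶜ) ≤ K u^{−ζ}` eventually in `u` (both guarded by
`0 < θ(p_c)`; the guard of the conclusion is fed to the pair-LRO hypothesis).

## Proof sketch

Write `m = ⌈u^x⌉₊`, `M = ⌈u^A⌉₊`, `P = P_{p_c}`.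
* Cerf 2015, Corollary 7.2 (bond, `AKN.real_compl_uniqZone_le_sum`):
  `P((uniqZone u M)ᶜ) ≤ Σ_{a,b ∈ Λ_u} P(twoArmsBox u (M−u) a b)`.
* Cerf 2015, Lemma 7.1 (bond, `AKN.real_twoArmsBox_mul_le`, with `n = u`, `n + k = m`, `n + ℓ = M`,
  valid once `m + 3 ≤ M`): `P(twoArmsBox u (M−u) a b) · P(a ↔ b via Λ_m) ≤
  (1 + |E(Λ_{m+1})|/p_c) |Λ_{m+1}| Σ_i P(edgeTwoArms i (M−m−2))`; the second factor is `≥ δ`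
  (`openConnIn ↑Λ_m a b ⊆ openConnVia (withinGraph ℤ³ Λ_m) a b` on lattice configurations,
  `openConnIn_eq_openConnVia` + `openClusterIn_withinGraph_eq_top`, transported to probabilities by
  `DCT16.real_mono_of_forall_subset_edgeSet`), so we divide by `δ` (`real_compl_uniqZone_le_of_conn`).
* Counting (`real_compl_uniqZone_le_poly`): `|Λ_u|² = (2u+1)⁶`, `|E(Λ_{m+1})| ≤ 6 |Λ_{m+1}| = 6 (2m+3)³`
  (`AKN.card_edgesIn_le`, `card_box`), `Σ_i ≤ 3 C (M−m−2)^{−κ}`; total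
  `≤ (2u+1)⁶ (1 + 6/p_c) (2m+3)⁶ · 3C (M−m−2)^{−κ} / δ`.
* Real analysis (`poly_bound`, `rpow_six_six_neg`, `eventually_one_le_and_rpow_le`): eventually
  `u^A ≥ 8 u^x` (as `u^{A−x} → ∞`), whence `m + 3 ≤ M`, `M − m − 2 ≥ u^A/2`, `2u+1 ≤ 3u`, `2m+3 ≤ 7u^x`,
  and the total is `≤ K u^{6 + 6x − κA} ≤ K u^{−ζ}` with `K = 3⁶ 7⁶ · 3 · 2^κ (1 + 6/p_c) C / δ`
  (`p_c > 0` by `Grimmett1999_criticalProb_pos_lt_one_holds`).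

## References

* R. Cerf, *A lower bound on the two-arms exponent for critical percolation on the lattice*, Ann. Probab. 43
  (2015), §7, Lemma 7.1 and Corollary 7.2 (arXiv:1306.3105 pp. 11–13) [Cerf2015].
* H. Duminil-Copin, G. Kozma, V. Tassion, arXiv:1902.03207, §7 [DuminilcopinKozmaTassion2020].
-/

noncomputable section

namespace Summit.CriticalPhenomena.PercolationContinuityZ3.Theorems

namespace NearLinearTwoClusterDecayLossyStep

open MeasureTheory Filter Topology
open Literature.Probability.LatticeModels Literature.Probability.Percolation

variable {d : ℕ}

/-! ## Cerf's Lemma 7.1 + Corollary 7.2 fed with a pair-connection lower bound -/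

/-- **Cerf 2015, Cor 7.2 + Lemma 7.1 (bond), divided by a pair-connection lower bound.** For
`k + 3 ≤ ℓ`, `p > 0` and `δ > 0` with `δ ≤ P_p(a ↔ b inside Λ_{n+k})` for all `a, b ∈ Λ_n`:
`P_p((uniqZone n (n+ℓ))ᶜ) ≤ |Λ_n|² (1 + |E(Λ_{n+k+1})|/p) |Λ_{n+k+1}| (Σ_i P_p(edgeTwoArms i (ℓ−k−2))) / δ`.
[cite: Cerf2015, Lemma 7.1 and Cor 7.2] -/
theorem real_compl_uniqZone_le_of_conn (p : unitInterval) (hp0 : 0 < (p : ℝ)) {n k ℓ : ℕ}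
    (hkℓ : k + 3 ≤ ℓ) {δ : ℝ} (hδ : 0 < δ)
    (hq : ∀ a ∈ box d n, ∀ b ∈ box d n,
      δ ≤ (bondPercolation (zdGraph d) p).real (openConnIn (↑(box d (n + k)) : Set (Site d)) a b)) :
    (bondPercolation (zdGraph d) p).real (uniqZone (d := d) n (n + ℓ))ᶜ ≤
      ((box d n).card : ℝ) ^ 2 * ((1 + (edgesIn (zdGraph d) (box d (n + k + 1))).card / p) *
        ((box d (n + k + 1)).card *
          ∑ i : Fin d, (bondPercolation (zdGraph d) p).real (AKN.edgeTwoArms i (ℓ - k - 2)))) / δ := by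
  set μ := bondPercolation (zdGraph d) p with hμ
  obtain ⟨Rf, hRf⟩ : ∃ Rf : ℝ, Rf = (1 + (edgesIn (zdGraph d) (box d (n + k + 1))).card / p) *
      ((box d (n + k + 1)).card * ∑ i : Fin d, μ.real (AKN.edgeTwoArms i (ℓ - k - 2))) := ⟨_, rfl⟩
  rw [← hRf]
  -- `openConnIn` (tree) versus `openConnVia (withinGraph ℤ^d ·)` (Cerf's files), a.s. equal
  have hvia : ∀ a ∈ box d n, ∀ b ∈ box d n,
      δ ≤ μ.real (openConnVia (withinGraph (zdGraph d) (↑(box d (n + k)) : Set (Site d))) a b) := by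
    intro a ha b hb
    refine (hq a ha b hb).trans
      (DCT16.real_mono_of_forall_subset_edgeSet (zdGraph d) p fun ω hω h => ?_)
    have ha' : a ∈ (↑(box d (n + k)) : Set (Site d)) :=
      Finset.mem_coe.2 (box_mono d (Nat.le_add_right n k) ha)
    rw [openConnIn_eq_openConnVia ha'] at h
    rw [openConnVia, Set.mem_setOf_eq, openClusterIn_withinGraph_eq_top (zdGraph d) _ hω]
    exact h
  have hpair : ∀ a ∈ box d n, ∀ b ∈ box d n, μ.real (AKN.twoArmsBox n ℓ a b) ≤ Rf / δ := by
    intro a ha b hb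
    have h71 := AKN.real_twoArmsBox_mul_le p hp0 (n := n) (k := k) hkℓ ha hb
    rw [← hRf] at h71
    rw [le_div_iff₀ hδ]
    calc μ.real (AKN.twoArmsBox n ℓ a b) * δ ≤ μ.real (AKN.twoArmsBox n ℓ a b) *
          μ.real (openConnVia (withinGraph (zdGraph d) (↑(box d (n + k)) : Set (Site d))) a b) :=
          mul_le_mul_of_nonneg_left (hvia a ha b hb) measureReal_nonneg
      _ ≤ Rf := h71
  calc μ.real (uniqZone (d := d) n (n + ℓ))ᶜ
      ≤ ∑ a ∈ box d n, ∑ b ∈ box d n, μ.real (AKN.twoArmsBox n ℓ a b) :=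
        AKN.real_compl_uniqZone_le_sum p n ℓ
    _ ≤ ∑ _a ∈ box d n, ∑ _b ∈ box d n, Rf / δ :=
        Finset.sum_le_sum fun a ha => Finset.sum_le_sum fun b hb => hpair a ha b hb
    _ = ((box d n).card : ℝ) ^ 2 * Rf / δ := by
        rw [Finset.sum_const, Finset.sum_const, nsmul_eq_mul, nsmul_eq_mul]; ring

/-- **The counted form on `ℤ³`.** With a two-arms exponent `κ` (`P_p(edgeTwoArms i m) ≤ C m^{-κ}`,
`m ≥ 1`, `C ≥ 0`), `n ≤ m`, `m + 3 ≤ M` and `δ ≤ P_p(a ↔ b inside Λ_m)` on `Λ_n²`: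
`P_p((uniqZone n M)ᶜ) ≤ (2n+1)⁶ (1 + 6/p) (2m+3)⁶ · 3C (M−m−2)^{−κ} / δ`
(`|Λ_n| = (2n+1)³`, `|E(Λ_{m+1})| ≤ 6 |Λ_{m+1}|`, three directions). [cite: Cerf2015, Lemma 7.1 and Cor 7.2] -/
theorem real_compl_uniqZone_le_poly (p : unitInterval) (hp0 : 0 < (p : ℝ)) {C κ δ : ℝ}
    (hδ : 0 < δ) (hC0 : 0 ≤ C)
    (hC : ∀ i : Fin 3, ∀ m : ℕ, 1 ≤ m →
      (bondPercolation (zdGraph 3) p).real (AKN.edgeTwoArms i m) ≤ C * (m : ℝ) ^ (-κ))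
    {n m M : ℕ} (hnm : n ≤ m) (hmM : m + 3 ≤ M)
    (hq : ∀ a ∈ box 3 n, ∀ b ∈ box 3 n,
      δ ≤ (bondPercolation (zdGraph 3) p).real (openConnIn (↑(box 3 m) : Set (Site 3)) a b)) :
    (bondPercolation (zdGraph 3) p).real (uniqZone (d := 3) n M)ᶜ ≤
      (2 * (n : ℝ) + 1) ^ 6 * ((1 + 6 / (p : ℝ)) * (2 * (m : ℝ) + 3) ^ 6 *
        (3 * C * ((M : ℝ) - m - 2) ^ (-κ))) / δ := by
  set μ := bondPercolation (zdGraph 3) p with hμ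
  obtain ⟨k, hk⟩ : ∃ k, m = n + k := ⟨m - n, by omega⟩
  obtain ⟨ℓ, hℓ⟩ : ∃ ℓ, M = n + ℓ := ⟨M - n, by omega⟩
  have hkℓ : k + 3 ≤ ℓ := by omega
  have hj1 : 1 ≤ ℓ - k - 2 := by omega
  have hcast : (((ℓ - k - 2 : ℕ)) : ℝ) = (M : ℝ) - m - 2 := by
    have h : ℓ - k - 2 + m + 2 = M := by omega
    have h' : (((ℓ - k - 2 : ℕ)) : ℝ) + m + 2 = M := by exact_mod_cast h
    linarith
  obtain ⟨t, ht⟩ : ∃ t : ℝ, t = (M : ℝ) - m - 2 := ⟨_, rfl⟩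
  rw [← ht] at hcast ⊢
  have ht0 : 0 < t := by
    rw [← hcast]; exact_mod_cast hj1
  obtain ⟨B, hB⟩ : ∃ B : ℝ, B = 2 * (m : ℝ) + 3 := ⟨_, rfl⟩
  rw [← hB]
  have hB1 : 1 ≤ B := by rw [hB]; linarith [(Nat.cast_nonneg m : (0 : ℝ) ≤ m)]
  have hB0 : 0 ≤ B := by linarith
  subst hk
  subst hℓ
  have hA := real_compl_uniqZone_le_of_conn p hp0 hkℓ hδ hq
  refine hA.trans (div_le_div_of_nonneg_right ?_ hδ.le)
  have hcard1 : ((box 3 n).card : ℝ) ^ 2 = (2 * (n : ℝ) + 1) ^ 6 := by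
    rw [card_box]; push_cast; ring
  have hcard2 : ((box 3 (n + k + 1)).card : ℝ) = B ^ 3 := by
    rw [card_box, hB]; push_cast; ring
  have hE : ((edgesIn (zdGraph 3) (box 3 (n + k + 1))).card : ℝ) ≤ 6 * B ^ 3 := by
    have h := AKN.card_edgesIn_le (d := 3) (box 3 (n + k + 1))
    have h' : ((edgesIn (zdGraph 3) (box 3 (n + k + 1))).card : ℝ) ≤
        2 * 3 * ((box 3 (n + k + 1)).card : ℝ) := by exact_mod_cast h
    rw [hcard2] at h'
    linarith
  have hS0 : 0 ≤ ∑ i : Fin 3, μ.real (AKN.edgeTwoArms i (ℓ - k - 2)) :=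
    Finset.sum_nonneg fun _ _ => measureReal_nonneg
  have hS : ∑ i : Fin 3, μ.real (AKN.edgeTwoArms i (ℓ - k - 2)) ≤ 3 * C * t ^ (-κ) := by
    rw [← hcast]
    calc ∑ i : Fin 3, μ.real (AKN.edgeTwoArms i (ℓ - k - 2))
        ≤ ∑ _i : Fin 3, C * (((ℓ - k - 2 : ℕ)) : ℝ) ^ (-κ) :=
          Finset.sum_le_sum fun i _ => hC i _ hj1
      _ = 3 * C * (((ℓ - k - 2 : ℕ)) : ℝ) ^ (-κ) := by
          rw [Finset.sum_const, Finset.card_univ, Fintype.card_fin, nsmul_eq_mul]; push_cast; ring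
  have hq0 : 0 ≤ 1 + 6 / (p : ℝ) := by positivity
  have h1 : 1 + ((edgesIn (zdGraph 3) (box 3 (n + k + 1))).card : ℝ) / p ≤ (1 + 6 / (p : ℝ)) * B ^ 3 := by
    have h2 : ((edgesIn (zdGraph 3) (box 3 (n + k + 1))).card : ℝ) / p ≤ 6 * B ^ 3 / p :=
      div_le_div_of_nonneg_right hE hp0.le
    have hB3 : 1 ≤ B ^ 3 := one_le_pow₀ hB1
    calc 1 + ((edgesIn (zdGraph 3) (box 3 (n + k + 1))).card : ℝ) / p ≤ 1 + 6 * B ^ 3 / p := by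
          linarith
      _ ≤ B ^ 3 + 6 * B ^ 3 / p := by linarith
      _ = (1 + 6 / (p : ℝ)) * B ^ 3 := by ring
  have htk : 0 ≤ 3 * C * t ^ (-κ) := mul_nonneg (mul_nonneg (by norm_num) hC0) (Real.rpow_nonneg ht0.le _)
  rw [hcard1, hcard2]
  refine mul_le_mul_of_nonneg_left ?_ (by positivity)
  calc (1 + ((edgesIn (zdGraph 3) (box 3 (n + k + 1))).card : ℝ) / p) *
        (B ^ 3 * ∑ i : Fin 3, μ.real (AKN.edgeTwoArms i (ℓ - k - 2)))
      ≤ ((1 + 6 / (p : ℝ)) * B ^ 3) * (B ^ 3 * (3 * C * t ^ (-κ))) :=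
        mul_le_mul h1 (mul_le_mul_of_nonneg_left hS (by positivity)) (mul_nonneg (by positivity) hS0)
          (by positivity)
    _ = (1 + 6 / (p : ℝ)) * B ^ 6 * (3 * C * t ^ (-κ)) := by ring

/-! ## Real analysis -/

/-- **The polynomial count against the scales.** For `U ≥ 1`, `1 ≤ P ≤ mr ≤ P + 1`, `Q ≤ Mr`,
`8P ≤ Q`, `q, C ≥ 0`, `δ > 0`, `κ ≥ 0`:
`(2U+1)⁶ q (2 mr + 3)⁶ · 3C (Mr − mr − 2)^{−κ} / δ ≤ (3⁶ 7⁶ · 3 · 2^κ q C / δ) · U⁶ P⁶ Q^{−κ}`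
(`2U+1 ≤ 3U`, `2mr+3 ≤ 7P`, `Mr − mr − 2 ≥ Q/2`). [folklore] -/
theorem poly_bound {U P Q mr Mr q C δ κ : ℝ} (hU : 1 ≤ U) (hP1 : 1 ≤ P) (hm1 : P ≤ mr)
    (hm2 : mr ≤ P + 1) (hM1 : Q ≤ Mr) (h8 : 8 * P ≤ Q) (hq : 0 ≤ q) (hC : 0 ≤ C) (hδ : 0 < δ)
    (hκ : 0 ≤ κ) :
    (2 * U + 1) ^ 6 * (q * (2 * mr + 3) ^ 6 * (3 * C * (Mr - mr - 2) ^ (-κ))) / δ ≤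
      3 ^ 6 * 7 ^ 6 * 3 * 2 ^ κ * q * C / δ * (U ^ (6 : ℕ) * P ^ (6 : ℕ) * Q ^ (-κ)) := by
  have hQ2 : 0 < Q / 2 := by linarith
  have ht : Q / 2 ≤ Mr - mr - 2 := by linarith
  have h1 : (2 * U + 1) ^ 6 ≤ (3 * U) ^ 6 := pow_le_pow_left₀ (by linarith) (by linarith) 6
  have h2 : (2 * mr + 3) ^ 6 ≤ (7 * P) ^ 6 := pow_le_pow_left₀ (by linarith) (by linarith) 6
  have h3 : (Mr - mr - 2) ^ (-κ) ≤ (Q / 2) ^ (-κ) := Real.rpow_le_rpow_of_nonpos hQ2 ht (by linarith)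
  have h4 : (Q / 2) ^ (-κ) = 2 ^ κ * Q ^ (-κ) := by
    rw [Real.div_rpow (by linarith) (by norm_num), Real.rpow_neg (by norm_num : (0 : ℝ) ≤ 2) κ,
      div_inv_eq_mul, mul_comm]
  have h0 : 0 ≤ (Mr - mr - 2) ^ (-κ) := Real.rpow_nonneg (by linarith) _
  have hP0 : 0 < P := by linarith
  have hU0 : 0 < U := by linarith
  have hmr0 : 0 ≤ 2 * mr + 3 := by linarith
  have h3C : 0 ≤ 3 * C * (Mr - mr - 2) ^ (-κ) := mul_nonneg (mul_nonneg (by norm_num) hC) h0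
  have hX : q * (2 * mr + 3) ^ 6 * (3 * C * (Mr - mr - 2) ^ (-κ)) ≤
      q * (7 * P) ^ 6 * (3 * C * (Q / 2) ^ (-κ)) :=
    mul_le_mul (mul_le_mul_of_nonneg_left h2 hq)
      (mul_le_mul_of_nonneg_left h3 (mul_nonneg (by norm_num) hC)) h3C (by positivity)
  have hY : (2 * U + 1) ^ 6 * (q * (2 * mr + 3) ^ 6 * (3 * C * (Mr - mr - 2) ^ (-κ))) ≤
      (3 * U) ^ 6 * (q * (7 * P) ^ 6 * (3 * C * (Q / 2) ^ (-κ))) :=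
    mul_le_mul h1 hX (mul_nonneg (mul_nonneg hq (pow_nonneg hmr0 6)) h3C) (by positivity)
  calc (2 * U + 1) ^ 6 * (q * (2 * mr + 3) ^ 6 * (3 * C * (Mr - mr - 2) ^ (-κ))) / δ
      ≤ (3 * U) ^ 6 * (q * (7 * P) ^ 6 * (3 * C * (Q / 2) ^ (-κ))) / δ :=
        div_le_div_of_nonneg_right hY hδ.le
    _ = 3 ^ 6 * 7 ^ 6 * 3 * 2 ^ κ * q * C / δ * (U ^ (6 : ℕ) * P ^ (6 : ℕ) * Q ^ (-κ)) := by
        rw [h4]; ring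

/-- **Collecting the powers**: `U⁶ (U^x)⁶ (U^A)^{−κ} = U^{6 + 6x − κA}` for `U > 0`. [folklore] -/
theorem rpow_six_six_neg {U x A κ : ℝ} (hU : 0 < U) :
    U ^ (6 : ℕ) * (U ^ x) ^ (6 : ℕ) * (U ^ A) ^ (-κ) = U ^ (6 + 6 * x - κ * A) := by
  have e1 : (U ^ x) ^ (6 : ℕ) = U ^ (6 * x) := by
    rw [← Real.rpow_natCast, ← Real.rpow_mul hU.le]; congr 1; push_cast; ring
  have e2 : (U ^ A) ^ (-κ) = U ^ (-(κ * A)) := by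
    rw [← Real.rpow_mul hU.le]; congr 1; ring
  have e3 : U ^ (6 : ℕ) = U ^ (6 : ℝ) := by exact_mod_cast (Real.rpow_natCast U 6).symm
  have e4 : 6 + 6 * x - κ * A = 6 + 6 * x + -(κ * A) := by ring
  rw [e4, Real.rpow_add hU, Real.rpow_add hU, e1, e2, e3]

/-- **The two scales separate**: for `x < A`, eventually in `u : ℕ`, `1 ≤ u` and `8 u^x ≤ u^A`
(since `u^{A−x} → ∞`). [folklore] -/
theorem eventually_one_le_and_rpow_le {x A : ℝ} (hxA : x < A) :
    ∀ᶠ u : ℕ in atTop, 1 ≤ u ∧ 8 * (u : ℝ) ^ x ≤ (u : ℝ) ^ A := by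
  have hev : ∀ᶠ u : ℕ in atTop, (8 : ℝ) ≤ (u : ℝ) ^ (A - x) :=
    ((tendsto_rpow_atTop (by linarith : 0 < A - x)).comp tendsto_natCast_atTop_atTop).eventually_ge_atTop 8
  filter_upwards [hev, eventually_ge_atTop 1] with u hu hu1
  refine ⟨hu1, ?_⟩
  have hU1 : (1 : ℝ) ≤ u := Nat.one_le_cast.2 hu1
  have hU : (0 : ℝ) < u := by linarith
  have hsplit : (u : ℝ) ^ A = (u : ℝ) ^ x * (u : ℝ) ^ (A - x) := by
    rw [← Real.rpow_add hU]; congr 1; ring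
  rw [hsplit]
  have hP : 0 ≤ (u : ℝ) ^ x := Real.rpow_nonneg hU.le x
  calc 8 * (u : ℝ) ^ x = (u : ℝ) ^ x * 8 := by ring
    _ ≤ (u : ℝ) ^ x * (u : ℝ) ^ (A - x) := mul_le_mul_of_nonneg_left hu hP

end NearLinearTwoClusterDecayLossyStep

open MeasureTheory Filter Topology
open Literature.Probability.LatticeModels Literature.Probability.Percolation
open NearLinearTwoClusterDecayLossyStep

/-- **Engine stub E1 `stub_lossyStep` of the line `pair-decay-long-arms-dense`** (registered): Cerf 2015
Lemma 7.1 + Corollary 7.2 (bond) at relay scale — pair-LRO at aspect `x` and a two-arms exponent `κ` give the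
union-form two-cluster rate `P_{p_c}((uniqZone u ⌈u^A⌉)ᶜ) ≤ C u^{-ζ}` for every `ζ ≤ κA − 6 − 6x`.
[cite: Cerf2015, Lemma 7.1 and Cor 7.2] -/
theorem stub_lossyStep :
    ∀ x κ A : ℝ, 1 ≤ x → 0 < κ → x < A →
    (∃ C : ℝ, ∀ i : Fin 3, ∀ m : ℕ, 1 ≤ m →
      (bondPercolation (zdGraph 3) (criticalProbI 3)).real (AKN.edgeTwoArms i m) ≤ C * (m : ℝ) ^ (-κ)) →
    (0 < theta (zdGraph 3) 0 (criticalProbI 3) → ∃ δ : ℝ, 0 < δ ∧ ∀ᶠ u : ℕ in atTop,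
      ∀ a ∈ box 3 u, ∀ b ∈ box 3 u,
        δ ≤ (bondPercolation (zdGraph 3) (criticalProbI 3)).real
          (openConnIn (↑(box 3 ⌈(u : ℝ) ^ x⌉₊) : Set (Site 3)) a b)) →
    ∀ ζ : ℝ, ζ ≤ κ * A - 6 - 6 * x →
    (0 < theta (zdGraph 3) 0 (criticalProbI 3) → ∃ C : ℝ, ∀ᶠ u : ℕ in atTop,
      (bondPercolation (zdGraph 3) (criticalProbI 3)).real (@uniqZone 3 u ⌈(u : ℝ) ^ A⌉₊)ᶜ ≤
        C * (u : ℝ) ^ (-ζ)) := by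
  intro x κ A hx hκ hxA hTA hP ζ hζ hθ
  obtain ⟨C, hC⟩ := hTA
  obtain ⟨δ, hδ, hLRO⟩ := hP hθ
  have hp0 : 0 < ((criticalProbI 3 : unitInterval) : ℝ) := by
    rw [coe_criticalProbI]
    exact (Grimmett1999_criticalProb_pos_lt_one_holds 3 (by norm_num)).1
  have hC0 : 0 ≤ C := by
    have h := hC 0 1 le_rfl
    rw [Nat.cast_one, Real.one_rpow, mul_one] at h
    exact measureReal_nonneg.trans h
  obtain ⟨q, hq⟩ : ∃ q : ℝ, q = 1 + 6 / ((criticalProbI 3 : unitInterval) : ℝ) := ⟨_, rfl⟩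
  have hq0 : 0 ≤ q := by rw [hq]; positivity
  obtain ⟨K, hK⟩ : ∃ K : ℝ, K = 3 ^ 6 * 7 ^ 6 * 3 * 2 ^ κ * q * C / δ := ⟨_, rfl⟩
  have hK0 : 0 ≤ K := by rw [hK]; positivity
  refine ⟨K, ?_⟩
  filter_upwards [hLRO, eventually_one_le_and_rpow_le hxA] with u hLROu h18
  obtain ⟨hu1, h8⟩ := h18
  have hU1 : (1 : ℝ) ≤ u := Nat.one_le_cast.2 hu1
  have hU0 : (0 : ℝ) < u := by linarith
  have hP1 : 1 ≤ (u : ℝ) ^ x := Real.one_le_rpow hU1 (by linarith)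
  have hm1 : (u : ℝ) ^ x ≤ (⌈(u : ℝ) ^ x⌉₊ : ℕ) := Nat.le_ceil _
  have hm2 : ((⌈(u : ℝ) ^ x⌉₊ : ℕ) : ℝ) ≤ (u : ℝ) ^ x + 1 :=
    (Nat.ceil_lt_add_one (by linarith)).le
  have hM1 : (u : ℝ) ^ A ≤ (⌈(u : ℝ) ^ A⌉₊ : ℕ) := Nat.le_ceil _
  have hum : u ≤ ⌈(u : ℝ) ^ x⌉₊ := le_nat_ceil_rpow hx u
  have hmM : ⌈(u : ℝ) ^ x⌉₊ + 3 ≤ ⌈(u : ℝ) ^ A⌉₊ := by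
    have h : ((⌈(u : ℝ) ^ x⌉₊ : ℕ) : ℝ) + 3 ≤ (⌈(u : ℝ) ^ A⌉₊ : ℕ) := by linarith
    exact_mod_cast h
  calc (bondPercolation (zdGraph 3) (criticalProbI 3)).real (@uniqZone 3 u ⌈(u : ℝ) ^ A⌉₊)ᶜ
      ≤ (2 * (u : ℝ) + 1) ^ 6 * ((1 + 6 / ((criticalProbI 3 : unitInterval) : ℝ)) *
          (2 * ((⌈(u : ℝ) ^ x⌉₊ : ℕ) : ℝ) + 3) ^ 6 *
            (3 * C * (((⌈(u : ℝ) ^ A⌉₊ : ℕ) : ℝ) - (⌈(u : ℝ) ^ x⌉₊ : ℕ) - 2) ^ (-κ))) / δ :=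
        real_compl_uniqZone_le_poly (criticalProbI 3) hp0 hδ hC0 hC hum hmM hLROu
    _ ≤ 3 ^ 6 * 7 ^ 6 * 3 * 2 ^ κ * q * C / δ *
          ((u : ℝ) ^ (6 : ℕ) * ((u : ℝ) ^ x) ^ (6 : ℕ) * ((u : ℝ) ^ A) ^ (-κ)) := by
        rw [hq]
        exact poly_bound hU1 hP1 hm1 hm2 hM1 h8 (hq ▸ hq0) hC0 hδ hκ.le
    _ = K * (u : ℝ) ^ (6 + 6 * x - κ * A) := by rw [rpow_six_six_neg hU0, hK]
    _ ≤ K * (u : ℝ) ^ (-ζ) :=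
        mul_le_mul_of_nonneg_left (Real.rpow_le_rpow_of_exponent_le hU1 (by linarith)) hK0

end Summit.CriticalPhenomena.PercolationContinuityZ3.Theorems
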